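import Mathlib
import HarnessLib
import Summits.Ventures.LatticeQCDFlow.Scoring.SU3HaarWeylDischarge
import Literature.MathematicalPhysics.QuantumFieldTheory.WilsonPlaquetteWeakCouplingFloor
import Literature.Combinatorics.SimpleGraph.CycleSpectrum

/-!
# LatticeQCDFlow / Scaling — an explicit small-ball bound for the Haar probability of `SU(3)`
# (`Haar{‖U − 1‖_F ≤ r} ≥ r⁸/(64000·π⁸)`) and the explicit, volume-uniform weak-coupling plaquette floor
# `⟨(1/3)Re tr U_p⟩_{Λ_L,β} ≥ 1 − (17 + 3 log K)/K`, `K = (d−1)β ≥ 2`, for `SU(3)` lattice gauge theory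

HONEST FRAMING: exact (Metropolis-corrected) sampling algorithms for lattice gauge theory;
figures of merit are autocorrelation/cost numbers at stated couplings and volumes; no
continuum-physics claim.

Venture `LatticeQCDFlow` (cell pub-lqcd), topic `Scaling`, FANOUT row 30 (lean-1, GEN-21) — OUR WORK: the
`SU(3)` input that makes the tree's group-agnostic weak-coupling plaquette floor
(`Literature/…/WilsonPlaquetteWeakCouplingFloor.wilsonExpectation_plaquette_ge_linkBall`, rate
`2 log φ_ρ(r)/((d−1)Nβ)` with `φ_ρ(r) = Haar{‖ρ(g) − 1‖_F ≤ r}`) EXPLICIT for `SU(3)` — the analogue of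
the tree's `Literature/…/SU2HaarSmallBall` (`SU(2)`: `Haar{2 − Re tr U ≤ η} ≥ η²/16`).  Tool: the tree's
Weyl integral formula for `SU(3)` (`Scoring/SU3HaarWeylDischarge.integral_haar_su3_traceFun_eq_integral2`,
row 5): a continuous minorant `g(Re tr U)` of the indicator integrates to
`(1/(24π²))∫∫ g(reTrSU3)·|Δ|² dθ`, and on the rectangle `θ₁ ∈ [2a/3, a]`, `θ₂ ∈ [0, a/6]`
(`a² = η/3`) the three eigen-angle gaps are `≥ a/2, 4a/3, 2a/3`, so `|Δ|² ≥ (4/π²)³(a/2)²(4a/3)²(2a/3)²`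
(`cos x ≤ 1 − 2x²/π²` on `|x| ≤ π`) while `Re tr ≥ 3 − 43η/108 ≥ 3 − η/2` (`cos x ≥ 1 − x²/2`).  The
order `η⁴ ≍ r⁸` is the true one (`dim SU(3) = 8`); the constant is not optimised.

## What is proved (all [ours])

* §1 `mul_le_intervalIntegral_of_le_on` — `c·(hi − lo) ≤ ∫_a^b f` for continuous `f ≥ 0` on `[a, b]`
  with `f ≥ c` on `[lo, hi] ⊆ [a, b]`.
* §2 `reTrSU3_ge_three_sub`, `weylSU3_ge_on_rect` (with the tree's Jordan bound
  `Literature.Combinatorics.SimpleGraph.mul_sq_le_two_sub_two_mul_cos`: `(4/π²)x² ≤ 2 − 2cos x`, `|x| ≤ π`).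
* §3 `torusIntegral_minorant_ge` (the rectangle floor on the torus side), `integral_minorant_le_haar_real`
  (the minorant integrates below the Haar mass); **`haar_su3_three_sub_trace_le_ge`** —
  `η⁴/(4000·π⁸) ≤ Haar{U ∈ SU(3) : 3 − Re tr U ≤ η}` for `0 < η ≤ 1`.
* §4 **`haarProbability_real_ball_ge_su3`** — `r⁸/(64000·π⁸) ≤ Haar{‖fundamentalRep (Fin 3) U − 1‖_F ≤ r}`
  for `0 < r`, `r² ≤ 2`.
* §5 `log_64000_mul_pi_pow_eight_le`; **`su3_floor_le`** — with `K = (d−1)β ≥ 2` and `r = K^{−1/2}` the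
  generic floor is `≥ 1 − (17 + 3 log K)/K`; **`wilsonExpectation_plaquette_ge_su3`** — for every
  `d ≥ 2`, `L`, site, axes `i ≠ j`, `K = (d−1)β ≥ 2`: `⟨(1/3)Re tr U_p⟩_{Λ_L,β} ≥ 1 − (17 + 3 log K)/K`,
  uniformly in the volume (the `SU(3)` twin of the tree's `wilsonExpectation_plaquette_ge_su2`; in `d = 4`,
  `K = 3β = β_W`).

No `def`, no `sorry`, nothing cited as a fact beyond the tree.
-/

noncomputable section

namespace Summit.Ventures.LatticeQCDFlow.Theory2.WeakCoupling

open MeasureTheory Real intervalIntegral Set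
open Summit.Ventures.LatticeQCDFlow.Scoring
open Literature.Combinatorics.SimpleGraph (mul_sq_le_two_sub_two_mul_cos)
open Literature.MathematicalPhysics.QuantumFieldTheory Literature.MathematicalPhysics.QuantumLattice
open scoped Matrix Matrix.Norms.Frobenius

/-! ## §1 A one-variable integral floor -/

/-- `c·(hi − lo) ≤ ∫_a^b f` for a continuous `f` that is `≥ 0` on `[a, b]` and `≥ c` on
`[lo, hi] ⊆ [a, b]`. [folklore] -/
theorem mul_le_intervalIntegral_of_le_on {f : ℝ → ℝ} {a b lo hi c : ℝ} (hf : Continuous f)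
    (ha : a ≤ lo) (hlh : lo ≤ hi) (hb : hi ≤ b)
    (h0 : ∀ x ∈ Icc a b, 0 ≤ f x) (hc : ∀ x ∈ Icc lo hi, c ≤ f x) :
    c * (hi - lo) ≤ ∫ x in a..b, f x := by
  have hi1 : IntervalIntegrable f volume a lo := hf.intervalIntegrable _ _
  have hi2 : IntervalIntegrable f volume lo hi := hf.intervalIntegrable _ _
  have hi3 : IntervalIntegrable f volume hi b := hf.intervalIntegrable _ _
  rw [← integral_add_adjacent_intervals hi1 (hi2.trans hi3), ← integral_add_adjacent_intervals hi2 hi3]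
  have h1 : 0 ≤ ∫ x in a..lo, f x :=
    integral_nonneg ha fun x hx => h0 x ⟨hx.1, hx.2.trans (hlh.trans hb)⟩
  have h3 : 0 ≤ ∫ x in hi..b, f x :=
    integral_nonneg hb fun x hx => h0 x ⟨(ha.trans hlh).trans hx.1, hx.2⟩
  have h2 : c * (hi - lo) ≤ ∫ x in lo..hi, f x := by
    have hm := integral_mono_on hlh (continuous_const.intervalIntegrable lo hi) hi2 hc
    rw [intervalIntegral.integral_const, smul_eq_mul] at hm
    linarith
  linarith

/-! ## §2 Pointwise bounds on the torus -/

/-- `Re tr U ≥ 3 − (θ₁² + θ₂² + (θ₁+θ₂)²)/2` on the maximal torus of `SU(3)`. [folklore] -/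
theorem reTrSU3_ge_three_sub (θ₁ θ₂ : ℝ) :
    3 - (θ₁ ^ 2 + θ₂ ^ 2 + (θ₁ + θ₂) ^ 2) / 2 ≤ reTrSU3 θ₁ θ₂ := by
  unfold reTrSU3
  have h1 := Real.one_sub_sq_div_two_le_cos (x := θ₁)
  have h2 := Real.one_sub_sq_div_two_le_cos (x := θ₂)
  have h3 := Real.one_sub_sq_div_two_le_cos (x := θ₁ + θ₂)
  linarith

/-- The Weyl density is bounded below by `(4/π²)³(a/2)²(4a/3)²(2a/3)²` on the rectangle
`θ₁ ∈ [2a/3, a]`, `θ₂ ∈ [0, a/6]` when `0 ≤ a` and `13a/6 ≤ π`. [ours] -/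
theorem weylSU3_ge_on_rect {a θ₁ θ₂ : ℝ} (ha0 : 0 ≤ a) (ha : 13 * a / 6 ≤ π)
    (h1 : 2 * a / 3 ≤ θ₁) (h1' : θ₁ ≤ a) (h2 : 0 ≤ θ₂) (h2' : θ₂ ≤ a / 6) :
    (4 / π ^ 2) ^ 3 * ((a / 2) ^ 2 * (4 * a / 3) ^ 2 * (2 * a / 3) ^ 2) ≤ weylSU3 θ₁ θ₂ := by
  unfold weylSU3
  have hπ := Real.pi_pos
  -- the three gaps
  have g1lo : a / 2 ≤ θ₁ - θ₂ := by linarith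
  have g1hi : θ₁ - θ₂ ≤ a := by linarith
  have g2lo : 4 * a / 3 ≤ 2 * θ₁ + θ₂ := by linarith
  have g2hi : 2 * θ₁ + θ₂ ≤ 13 * a / 6 := by linarith
  have g3lo : 2 * a / 3 ≤ θ₁ + 2 * θ₂ := by linarith
  have g3hi : θ₁ + 2 * θ₂ ≤ 4 * a / 3 := by linarith
  have abs1 : |θ₁ - θ₂| ≤ π := by rw [abs_of_nonneg (by linarith)]; linarith
  have abs2 : |2 * θ₁ + θ₂| ≤ π := by rw [abs_of_nonneg (by linarith)]; linarith
  have abs3 : |θ₁ + 2 * θ₂| ≤ π := by rw [abs_of_nonneg (by linarith)]; linarith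
  have f1 := mul_sq_le_two_sub_two_mul_cos abs1
  have f2 := mul_sq_le_two_sub_two_mul_cos abs2
  have f3 := mul_sq_le_two_sub_two_mul_cos abs3
  have hk : 0 ≤ 4 / π ^ 2 := by positivity
  have s1 : (a / 2) ^ 2 ≤ (θ₁ - θ₂) ^ 2 := pow_le_pow_left₀ (by linarith) g1lo 2
  have s2 : (4 * a / 3) ^ 2 ≤ (2 * θ₁ + θ₂) ^ 2 := pow_le_pow_left₀ (by linarith) g2lo 2
  have s3 : (2 * a / 3) ^ 2 ≤ (θ₁ + 2 * θ₂) ^ 2 := pow_le_pow_left₀ (by linarith) g3lo 2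
  have e1 : 4 / π ^ 2 * (a / 2) ^ 2 ≤ 2 - 2 * Real.cos (θ₁ - θ₂) :=
    (mul_le_mul_of_nonneg_left s1 hk).trans f1
  have e2 : 4 / π ^ 2 * (4 * a / 3) ^ 2 ≤ 2 - 2 * Real.cos (2 * θ₁ + θ₂) :=
    (mul_le_mul_of_nonneg_left s2 hk).trans f2
  have e3 : 4 / π ^ 2 * (2 * a / 3) ^ 2 ≤ 2 - 2 * Real.cos (θ₁ + 2 * θ₂) :=
    (mul_le_mul_of_nonneg_left s3 hk).trans f3
  have n1 : 0 ≤ 4 / π ^ 2 * (a / 2) ^ 2 := by positivity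
  have n2 : 0 ≤ 4 / π ^ 2 * (4 * a / 3) ^ 2 := by positivity
  have n3 : 0 ≤ 4 / π ^ 2 * (2 * a / 3) ^ 2 := by positivity
  calc (4 / π ^ 2) ^ 3 * ((a / 2) ^ 2 * (4 * a / 3) ^ 2 * (2 * a / 3) ^ 2)
      = (4 / π ^ 2 * (a / 2) ^ 2) * (4 / π ^ 2 * (4 * a / 3) ^ 2) * (4 / π ^ 2 * (2 * a / 3) ^ 2) := by
        ring
    _ ≤ (2 - 2 * Real.cos (θ₁ - θ₂)) * (2 - 2 * Real.cos (2 * θ₁ + θ₂)) *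
          (2 - 2 * Real.cos (θ₁ + 2 * θ₂)) :=
        mul_le_mul (mul_le_mul e1 e2 n2 (n1.trans e1)) e3 n3
          (mul_nonneg (n1.trans e1) (n2.trans e2))

/-! ## §3 The small-ball bound in the trace variable -/

/-- The torus side: for `0 < η ≤ 1`,
`η⁴/(4000·π⁸) ≤ (1/(24π²))∫₀^{2π}∫₀^{2π} g_η(reTrSU3)·|Δ|²`, `g_η(t) = min 1 (max 0 ((t − (3 − η))·(2/η)))`
(the rectangle `[2a/3, a] × [0, a/6]`, `a² = η/3`). [ours] -/
theorem torusIntegral_minorant_ge {η : ℝ} (hη0 : 0 < η) (hη : η ≤ 1) :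
    η ^ 4 / (4000 * π ^ 8) ≤ 1 / (6 * (2 * π) ^ 2) * ∫ θ₁ in (0 : ℝ)..2 * π, ∫ θ₂ in (0 : ℝ)..2 * π,
      min 1 (max 0 ((reTrSU3 θ₁ θ₂ - (3 - η)) * (2 / η))) * weylSU3 θ₁ θ₂ := by
  have hπ := Real.pi_pos
  have hg0 : ∀ t : ℝ, 0 ≤ min 1 (max 0 ((t - (3 - η)) * (2 / η))) :=
    fun t => le_min zero_le_one (le_max_left _ _)
  have hgone : ∀ t : ℝ, 3 - η / 2 ≤ t → min 1 (max 0 ((t - (3 - η)) * (2 / η))) = 1 := by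
    intro t ht
    apply min_eq_left
    refine le_trans ?_ (le_max_right _ _)
    rw [show (1 : ℝ) = (η / 2) * (2 / η) by field_simp]
    exact mul_le_mul_of_nonneg_right (by linarith) (by positivity)
  obtain ⟨a, ha0, ha2, ha1⟩ : ∃ a : ℝ, 0 < a ∧ a ^ 2 = η / 3 ∧ a ≤ 1 := by
    refine ⟨Real.sqrt (η / 3), Real.sqrt_pos.2 (by positivity), Real.sq_sqrt (by positivity), ?_⟩
    rw [show (1 : ℝ) = Real.sqrt 1 by simp]
    exact Real.sqrt_le_sqrt (by linarith)
  have h13 : 13 * a / 6 ≤ π := by linarith [Real.pi_gt_three]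
  have hgc : Continuous fun t : ℝ => min 1 (max 0 ((t - (3 - η)) * (2 / η))) :=
    continuous_const.min (continuous_const.max ((continuous_id.sub continuous_const).mul
      continuous_const))
  have hhc : Continuous fun p : ℝ × ℝ =>
      (fun θ₁ θ₂ : ℝ => min 1 (max 0 ((reTrSU3 θ₁ θ₂ - (3 - η)) * (2 / η))) * weylSU3 θ₁ θ₂) p.1 p.2 :=
    (hgc.comp (continuous_reTrSU3_comp continuous_fst continuous_snd)).mul
      (continuous_weylSU3_comp continuous_fst continuous_snd)
  have hh0 : ∀ θ₁ θ₂ : ℝ, 0 ≤ min 1 (max 0 ((reTrSU3 θ₁ θ₂ - (3 - η)) * (2 / η))) * weylSU3 θ₁ θ₂ :=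
    fun θ₁ θ₂ => mul_nonneg (hg0 _) (weylSU3_nonneg _ _)
  -- on the rectangle the integrand is `weylSU3 ≥ c₀`
  have hrect : ∀ θ₁ ∈ Icc (2 * a / 3) a, ∀ θ₂ ∈ Icc 0 (a / 6),
      (4 / π ^ 2) ^ 3 * ((a / 2) ^ 2 * (4 * a / 3) ^ 2 * (2 * a / 3) ^ 2) ≤
        min 1 (max 0 ((reTrSU3 θ₁ θ₂ - (3 - η)) * (2 / η))) * weylSU3 θ₁ θ₂ := by
    intro θ₁ hθ₁ θ₂ hθ₂
    have htr : 3 - η / 2 ≤ reTrSU3 θ₁ θ₂ := by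
      refine le_trans ?_ (reTrSU3_ge_three_sub θ₁ θ₂)
      have b1 : θ₁ ^ 2 ≤ a ^ 2 := pow_le_pow_left₀ (by linarith [hθ₁.1]) hθ₁.2 2
      have b2 : θ₂ ^ 2 ≤ (a / 6) ^ 2 := pow_le_pow_left₀ hθ₂.1 hθ₂.2 2
      have b3 : (θ₁ + θ₂) ^ 2 ≤ (7 * a / 6) ^ 2 :=
        pow_le_pow_left₀ (by linarith [hθ₁.1, hθ₂.1]) (by linarith [hθ₁.2, hθ₂.2]) 2
      have e2 : (a / 6) ^ 2 = a ^ 2 / 36 := by ring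
      have e3 : (7 * a / 6) ^ 2 = 49 * a ^ 2 / 36 := by ring
      rw [e2] at b2
      rw [e3] at b3
      rw [ha2] at b1 b2 b3
      linarith
    rw [hgone _ htr, one_mul]
    exact weylSU3_ge_on_rect ha0.le h13 hθ₁.1 hθ₁.2 hθ₂.1 hθ₂.2
  -- inner floor
  have hinner : ∀ θ₁ ∈ Icc (2 * a / 3) a,
      (4 / π ^ 2) ^ 3 * ((a / 2) ^ 2 * (4 * a / 3) ^ 2 * (2 * a / 3) ^ 2) * (a / 6 - 0) ≤
        ∫ θ₂ in (0 : ℝ)..2 * π, min 1 (max 0 ((reTrSU3 θ₁ θ₂ - (3 - η)) * (2 / η))) * weylSU3 θ₁ θ₂ := by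
    intro θ₁ hθ₁
    have hc1 : Continuous fun θ₂ : ℝ =>
        min 1 (max 0 ((reTrSU3 θ₁ θ₂ - (3 - η)) * (2 / η))) * weylSU3 θ₁ θ₂ :=
      (hgc.comp (continuous_reTrSU3_comp continuous_const continuous_id)).mul
        (continuous_weylSU3_comp continuous_const continuous_id)
    exact mul_le_intervalIntegral_of_le_on hc1 le_rfl (by positivity) (by linarith)
      (fun θ₂ _ => hh0 θ₁ θ₂) (fun θ₂ hθ₂ => hrect θ₁ hθ₁ θ₂ hθ₂)
  -- outer floor
  have hφc : Continuous fun θ₁ : ℝ => ∫ θ₂ in (0 : ℝ)..2 * π,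
      min 1 (max 0 ((reTrSU3 θ₁ θ₂ - (3 - η)) * (2 / η))) * weylSU3 θ₁ θ₂ :=
    continuous_inner_integral
      (g := fun θ₁ θ₂ : ℝ => min 1 (max 0 ((reTrSU3 θ₁ θ₂ - (3 - η)) * (2 / η))) * weylSU3 θ₁ θ₂)
      hhc 0 (2 * π)
  have houter : (4 / π ^ 2) ^ 3 * ((a / 2) ^ 2 * (4 * a / 3) ^ 2 * (2 * a / 3) ^ 2) * (a / 6 - 0) *
        (a - 2 * a / 3) ≤
      ∫ θ₁ in (0 : ℝ)..2 * π, ∫ θ₂ in (0 : ℝ)..2 * π,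
        min 1 (max 0 ((reTrSU3 θ₁ θ₂ - (3 - η)) * (2 / η))) * weylSU3 θ₁ θ₂ :=
    mul_le_intervalIntegral_of_le_on hφc (by positivity) (by linarith) (by linarith)
      (fun θ₁ _ => integral_nonneg (by positivity) fun θ₂ _ => hh0 θ₁ θ₂) hinner
  -- arithmetic
  have e : 1 / (6 * (2 * π) ^ 2) * ((4 / π ^ 2) ^ 3 * ((a / 2) ^ 2 * (4 * a / 3) ^ 2 * (2 * a / 3) ^ 2) *
      (a / 6 - 0) * (a - 2 * a / 3)) = (a ^ 2) ^ 4 * (1024 / (34992 * π ^ 8)) := by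
    field_simp
    ring
  have hfin : η ^ 4 / (4000 * π ^ 8) ≤ (a ^ 2) ^ 4 * (1024 / (34992 * π ^ 8)) := by
    rw [ha2, div_le_iff₀ (by positivity)]
    have e2 : (η / 3) ^ 4 * (1024 / (34992 * π ^ 8)) * (4000 * π ^ 8) = η ^ 4 * (4096000 / 2834352) := by
      field_simp
      ring
    rw [e2]
    nlinarith [pow_pos hη0 4]
  calc η ^ 4 / (4000 * π ^ 8) ≤ (a ^ 2) ^ 4 * (1024 / (34992 * π ^ 8)) := hfin
    _ = 1 / (6 * (2 * π) ^ 2) * ((4 / π ^ 2) ^ 3 * ((a / 2) ^ 2 * (4 * a / 3) ^ 2 * (2 * a / 3) ^ 2) *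
          (a / 6 - 0) * (a - 2 * a / 3)) := e.symm
    _ ≤ _ := mul_le_mul_of_nonneg_left houter (by positivity)

/-- The group side: `∫ g_η(Re tr U) dHaar ≤ Haar{3 − Re tr U ≤ η}` (`g_η ≤` the indicator). [ours] -/
theorem integral_minorant_le_haar_real {η : ℝ} (hη0 : 0 < η) :
    ∫ U, min 1 (max 0 ((((U : Matrix (Fin 3) (Fin 3) ℂ).trace).re - (3 - η)) * (2 / η)))
        ∂(haarProbability (Matrix.specialUnitaryGroup (Fin 3) ℂ)) ≤
      (haarProbability (Matrix.specialUnitaryGroup (Fin 3) ℂ)).real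
        {U : Matrix.specialUnitaryGroup (Fin 3) ℂ | 3 - ((U : Matrix (Fin 3) (Fin 3) ℂ).trace).re ≤ η} := by
  have hg0 : ∀ t : ℝ, 0 ≤ min 1 (max 0 ((t - (3 - η)) * (2 / η))) :=
    fun t => le_min zero_le_one (le_max_left _ _)
  have hg1 : ∀ t : ℝ, min 1 (max 0 ((t - (3 - η)) * (2 / η))) ≤ 1 := fun t => min_le_left _ _
  have hgzero : ∀ t : ℝ, t < 3 - η → min 1 (max 0 ((t - (3 - η)) * (2 / η))) = 0 := by
    intro t ht
    have hneg : (t - (3 - η)) * (2 / η) ≤ 0 :=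
      mul_nonpos_of_nonpos_of_nonneg (by linarith) (by positivity)
    rw [max_eq_left hneg, min_eq_right zero_le_one]
  have hretr : Continuous fun U : Matrix.specialUnitaryGroup (Fin 3) ℂ =>
      ((U : Matrix (Fin 3) (Fin 3) ℂ).trace).re :=
    Complex.continuous_re.comp ((continuous_id.matrix_trace).comp continuous_subtype_val)
  have hSm : MeasurableSet
      {U : Matrix.specialUnitaryGroup (Fin 3) ℂ | 3 - ((U : Matrix (Fin 3) (Fin 3) ℂ).trace).re ≤ η} :=
    measurableSet_le (continuous_const.sub hretr).measurable measurable_const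
  rw [← integral_indicator_one hSm]
  refine integral_mono_of_nonneg (ae_of_all _ fun U => hg0 _) ((integrable_const (1 : ℝ)).indicator hSm)
    (ae_of_all _ fun U => ?_)
  by_cases hU : U ∈ {U : Matrix.specialUnitaryGroup (Fin 3) ℂ |
      3 - ((U : Matrix (Fin 3) (Fin 3) ℂ).trace).re ≤ η}
  · rw [Set.indicator_of_mem hU]; exact hg1 _
  · rw [Set.indicator_of_notMem hU]
    have hlt : ((U : Matrix (Fin 3) (Fin 3) ℂ).trace).re < 3 - η := by
      simp only [Set.mem_setOf_eq, not_le] at hU; linarith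
    exact (hgzero _ hlt).le

/-- **`Haar{U ∈ SU(3) : 3 − Re tr U ≤ η} ≥ η⁴/(4000·π⁸)`** for `0 < η ≤ 1`. [ours] -/
theorem haar_su3_three_sub_trace_le_ge {η : ℝ} (hη0 : 0 < η) (hη : η ≤ 1) :
    η ^ 4 / (4000 * π ^ 8) ≤ (haarProbability (Matrix.specialUnitaryGroup (Fin 3) ℂ)).real
      {U : Matrix.specialUnitaryGroup (Fin 3) ℂ | 3 - ((U : Matrix (Fin 3) (Fin 3) ℂ).trace).re ≤ η} := by
  have hgc : Continuous fun t : ℝ => min 1 (max 0 ((t - (3 - η)) * (2 / η))) :=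
    continuous_const.min (continuous_const.max ((continuous_id.sub continuous_const).mul
      continuous_const))
  have hweyl := SU3Haar.integral_haar_su3_traceFun_eq_integral2
    (fun t : ℝ => min 1 (max 0 ((t - (3 - η)) * (2 / η)))) hgc
  beta_reduce at hweyl
  exact (torusIntegral_minorant_ge hη0 hη).trans (hweyl ▸ integral_minorant_le_haar_real hη0)

/-! ## §4 The Frobenius-ball form -/

/-- **`Haar{U ∈ SU(3) : ‖U − 1‖_F ≤ r} ≥ r⁸/(64000·π⁸)`** for `0 < r`, `r² ≤ 2`
(`‖U − 1‖_F² = 2(3 − Re tr U)` on `SU(3)`, `η = r²/2`). [ours] -/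
theorem haarProbability_real_ball_ge_su3 {r : ℝ} (hr : 0 < r) (hr2 : r ^ 2 ≤ 2) :
    r ^ 8 / (64000 * π ^ 8) ≤ (haarProbability (Matrix.specialUnitaryGroup (Fin 3) ℂ)).real
      {U : Matrix.specialUnitaryGroup (Fin 3) ℂ | ‖fundamentalRep (Fin 3) U - 1‖ ≤ r} := by
  have hη0 : 0 < r ^ 2 / 2 := by positivity
  have hη : r ^ 2 / 2 ≤ 1 := by linarith
  have hsub : {U : Matrix.specialUnitaryGroup (Fin 3) ℂ |
        3 - ((U : Matrix (Fin 3) (Fin 3) ℂ).trace).re ≤ r ^ 2 / 2} ⊆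
      {U : Matrix.specialUnitaryGroup (Fin 3) ℂ | ‖fundamentalRep (Fin 3) U - 1‖ ≤ r} := by
    intro U hU
    have hU' : (3 : ℝ) - ((U : Matrix (Fin 3) (Fin 3) ℂ).trace).re ≤ r ^ 2 / 2 := hU
    have hid := sub_re_trace_eq_half_norm_sub_one_sq (fundamentalRep_mem_unitaryGroup U)
    rw [fundamentalRep_apply] at hid
    have hsq : ‖(U : Matrix (Fin 3) (Fin 3) ℂ) - 1‖ ^ 2 ≤ r ^ 2 := by
      have : ((3 : ℕ) : ℝ) = 3 := by norm_num
      rw [this] at hid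
      linarith
    show ‖fundamentalRep (Fin 3) U - 1‖ ≤ r
    rw [fundamentalRep_apply]
    exact (pow_le_pow_iff_left₀ (norm_nonneg _) hr.le two_ne_zero).1 hsq
  have h := haar_su3_three_sub_trace_le_ge hη0 hη
  have h64 : r ^ 8 / (64000 * π ^ 8) = (r ^ 2 / 2) ^ 4 / (4000 * π ^ 8) := by ring
  rw [h64]
  exact h.trans (measureReal_mono hsub)

/-! ## §5 The explicit weak-coupling plaquette floor for `SU(3)` -/

/-- `log(64000·π⁸) ≤ 41/2` (`π < 3.15`, `e > 2.718281828`, `e^{1/2} ≥ 3/2`). [folklore] -/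
theorem log_64000_mul_pi_pow_eight_le : Real.log (64000 * π ^ 8) ≤ 41 / 2 := by
  have hπ := Real.pi_pos
  have h1 : 64000 * π ^ 8 ≤ 64000 * (3.15 : ℝ) ^ 8 := by
    have := Real.pi_lt_d2
    gcongr
  have h2 : (64000 : ℝ) * (3.15 : ℝ) ^ 8 ≤ (2.7182818283 : ℝ) ^ 20 * (1 + 1 / 2) := by norm_num
  have h3 : (2.7182818283 : ℝ) ^ 20 * (1 + 1 / 2) ≤ Real.exp (41 / 2) := by
    have e1 : (2.7182818283 : ℝ) ≤ Real.exp 1 := Real.exp_one_gt_d9.le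
    have e2 : (1 : ℝ) + 1 / 2 ≤ Real.exp (1 / 2) := by linarith [Real.add_one_le_exp (1 / 2 : ℝ)]
    calc (2.7182818283 : ℝ) ^ 20 * (1 + 1 / 2) ≤ Real.exp 1 ^ 20 * Real.exp (1 / 2) :=
          mul_le_mul (pow_le_pow_left₀ (by norm_num) e1 20) e2 (by norm_num) (by positivity)
      _ = Real.exp (41 / 2) := by
          rw [← Real.exp_nat_mul, ← Real.exp_add]; norm_num
  rw [Real.log_le_iff_le_exp (by positivity)]
  linarith

/-- **The explicit `SU(3)` floor.**  For `d ≥ 2` and `K := (d−1)β ≥ 2`, with the radius `r = K^{−1/2}`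
(`r² = 1/K ≤ 1/2`), the floor of `wilsonExpectation_plaquette_ge_linkBall` for `SU(3)` in the fundamental
representation is at least `1 − (17 + 3 log K)/K`: `8r²/3 = 8/(3K)`,
`log φ(r) ≥ log(r⁸/(64000π⁸)) = −4 log K − log(64000π⁸) ≥ −4 log K − 41/2`. [ours] -/
theorem su3_floor_le {d : ℕ} (hd : 2 ≤ d) {β : ℝ} (hK : 2 ≤ ((d : ℝ) - 1) * β) :
    1 - (17 + 3 * Real.log (((d : ℝ) - 1) * β)) / (((d : ℝ) - 1) * β) ≤
      1 - 8 * Real.sqrt (1 / (((d : ℝ) - 1) * β)) ^ 2 / (3 : ℕ) +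
        2 * Real.log ((haarProbability (Matrix.specialUnitaryGroup (Fin 3) ℂ)).real
            {U : Matrix.specialUnitaryGroup (Fin 3) ℂ |
              ‖fundamentalRep (Fin 3) U - 1‖ ≤ Real.sqrt (1 / (((d : ℝ) - 1) * β))}) /
          (((d : ℝ) - 1) * (3 : ℕ) * β) := by
  have hd1 : (0 : ℝ) < (d : ℝ) - 1 := by
    have : (2 : ℝ) ≤ d := by exact_mod_cast hd
    linarith
  set K : ℝ := ((d : ℝ) - 1) * β with hKdef
  have hK0 : 0 < K := by linarith
  have hβ0 : β ≠ 0 := by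
    rintro rfl
    simp [hKdef] at hK0
  set r : ℝ := Real.sqrt (1 / K) with hr
  have hr0 : 0 < r := Real.sqrt_pos.2 (by positivity)
  have hr2 : r ^ 2 = 1 / K := by rw [hr, Real.sq_sqrt (by positivity)]
  have hr2le : r ^ 2 ≤ 2 := by
    rw [hr2]
    exact (one_div_le_one_div_of_le (by norm_num) hK).trans (by norm_num)
  set φ : ℝ := (haarProbability (Matrix.specialUnitaryGroup (Fin 3) ℂ)).real
    {U : Matrix.specialUnitaryGroup (Fin 3) ℂ | ‖fundamentalRep (Fin 3) U - 1‖ ≤ r} with hφ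
  have hφge : r ^ 8 / (64000 * π ^ 8) ≤ φ := haarProbability_real_ball_ge_su3 hr0 hr2le
  have hr8 : 0 < r ^ 8 / (64000 * π ^ 8) := by positivity
  have hlogK : 0 ≤ Real.log K := Real.log_nonneg (by linarith)
  have hlog : -4 * Real.log K - 41 / 2 ≤ Real.log φ := by
    have h1 : Real.log (r ^ 8 / (64000 * π ^ 8)) ≤ Real.log φ := Real.log_le_log hr8 hφge
    have h2 : Real.log (r ^ 8 / (64000 * π ^ 8)) = 4 * Real.log (r ^ 2) - Real.log (64000 * π ^ 8) := by
      rw [Real.log_div (by positivity) (by positivity), show r ^ 8 = (r ^ 2) ^ 4 by ring, Real.log_pow]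
      ring
    have h3 : Real.log (r ^ 2) = -Real.log K := by
      rw [hr2, one_div, Real.log_inv]
    linarith [log_64000_mul_pi_pow_eight_le]
  have key : (49 / 3 + 8 / 3 * Real.log K) / K ≤ (17 + 3 * Real.log K) / K :=
    div_le_div_of_nonneg_right (by linarith) hK0.le
  have e2 : 8 * r ^ 2 / ((3 : ℕ) : ℝ) = 8 / 3 / K := by
    rw [hr2]; push_cast; field_simp
  have e3 : 2 * Real.log φ / (((d : ℝ) - 1) * ((3 : ℕ) : ℝ) * β) = 2 / 3 * Real.log φ / K := by
    rw [hKdef]; push_cast; field_simp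
  rw [e2, e3]
  have e4 : 8 / 3 / K - 2 / 3 * Real.log φ / K = (8 / 3 - 2 / 3 * Real.log φ) / K := by ring
  have hnum : 8 / 3 - 2 / 3 * Real.log φ ≤ 49 / 3 + 8 / 3 * Real.log K := by linarith
  have key2 : (8 / 3 - 2 / 3 * Real.log φ) / K ≤ (17 + 3 * Real.log K) / K :=
    (div_le_div_of_nonneg_right hnum hK0.le).trans key
  linarith

/-- **The `SU(3)` plaquette at weak coupling, explicit and uniform in the volume.**  For every `d ≥ 2`,
torus size `L`, site `x`, axes `i ≠ j` and every `β` with `K = (d−1)β ≥ 2`: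
`⟨(1/3) Re tr U_{x,ij}⟩_{Λ_L,β} ≥ 1 − (17 + 3 log K)/K` — the internal energy of `SU(3)` lattice gauge
theory (tree units: `β` multiplies `Σ_p (3 − Re tr U_p)`, `β = β_W/3`) is at most `(17 + 3 log K)/K`,
UNIFORMLY IN THE VOLUME. [ours] -/
theorem wilsonExpectation_plaquette_ge_su3 {d L : ℕ} [NeZero L] (hd : 2 ≤ d) {β : ℝ}
    (hK : 2 ≤ ((d : ℝ) - 1) * β) (x : Site d L) {i j : Fin d} (hij : i ≠ j) :
    1 - (17 + 3 * Real.log (((d : ℝ) - 1) * β)) / (((d : ℝ) - 1) * β) ≤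
      wilsonExpectation (fundamentalRep (Fin 3)) β
        (fun U : GaugeConfig d L (Matrix.specialUnitaryGroup (Fin 3) ℂ) =>
          ((3 : ℕ) : ℝ)⁻¹ * (fundamentalRep (Fin 3) (plaquetteHolonomy U x i j)).trace.re) := by
  have hd1 : (0 : ℝ) < (d : ℝ) - 1 := by
    have : (2 : ℝ) ≤ d := by exact_mod_cast hd
    linarith
  have hβ : 0 < β := by
    by_contra h
    have : ((d : ℝ) - 1) * β ≤ 0 := mul_nonpos_of_nonneg_of_nonpos hd1.le (not_lt.1 h)
    linarith
  have hr0 : 0 < Real.sqrt (1 / (((d : ℝ) - 1) * β)) := Real.sqrt_pos.2 (by positivity)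
  exact (su3_floor_le hd hK).trans
    (wilsonExpectation_plaquette_ge_linkBall (fundamentalRep (Fin 3)) hd (by norm_num)
      (continuous_fundamentalRep (Fin 3)) fundamentalRep_mem_unitaryGroup hβ hr0 x hij)

end Summit.Ventures.LatticeQCDFlow.Theory2.WeakCoupling

end
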